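import Mathlib
import Summits.NavierStokesRegularity.NavierStokesRegularity.Theorems.FilamentSkeletonRssAreaLawSlavingHoloSlipZeros

/-!
# Area-law slaving, complex part 6 — the FACTOR-TWO WINDOW of `StadiumAnalyticArea` from a relative derivative bound
# (`FilamentSkeletonRss`, child crux `TangentSkeletonNearStraight`, stmt-NavierStokesRegularity-28295, line
# `child_tangent_analytic_strip`, ∃-side of the registered stub `stub_analyticClosing`: the `StadiumAnalyticArea` conjunct)

The third clause of `StadiumAnalyticArea hs L cc A` asks, for the continuation `G` of the core area `A`, the window
`A(Re z)/2 ≤ Re G(z)` and `‖G(z)‖ ≤ 2·A(Re z)` on the stadium.  The core area varies by orders of magnitude along the ball segment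
(`A ∼ C·τ²` on the arms, scale `√Γ`), so no absolute Lipschitz bound can give this on a stadium of width `cs√Γ`; the right input is a
RELATIVE bound `‖G′(z)‖ ≤ κ·A(Re z)` (a log-derivative bound at the waist scale, `κ ∼ Γ^{-1/2}`) together with thinness `κ·|Im z| ≤ 1/2`
(`cs` small).  This file proves that reduction on any open convex domain containing the real feet of its points (a stadium is a
rectangle):

* `norm_sub_foot_le` — `‖G(z) − G(Re z)‖ ≤ κ·A(Re z)·|Im z|` from the relative bound along the vertical segment;
* `stadium_window_of_relative_deriv_bound` — hence `A(Re z)/2 ≤ Re G(z)` and `‖G(z)‖ ≤ 2·A(Re z)` when `κ|Im z| ≤ 1/2`, in the exact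
  form of the `StadiumAnalyticArea` clause (with `G ↑x = ↑(A x)` on the trace).

Left (census): the relative derivative bound itself for the continued regular solution of part 4 (Frobenius structure near `c`,
the ODE `G′ = ((3/2 − w′)G + 4)/w` with the slip floor away from `c`), and the identification of the trace with the slaved area.

HONEST FRAMING: elementary complex analysis serving a HYPOTHETICAL filament skeleton on the NEGATIVE side of a MODEL route; no registered
stub is closed by this file and nothing here bears on Navier–Stokes regularity or blow-up.  `--supports stmt-NavierStokesRegularity-28295`.
-/

set_option linter.dupNamespace false

noncomputable section

namespace Summit.NavierStokesRegularity.NavierStokesRegularity.Theorems.AreaLawSlavingHolo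

open Set MeasureTheory Metric Filter
open scoped Topology

/-- Points of the vertical segment from the real foot `Re z` to `z` have real part `Re z`. [folklore] -/
theorem re_foot_add (z : ℂ) (t : ℝ) : ((z.re : ℂ) + (t : ℂ) * (z - (z.re : ℂ))).re = z.re := by
  simp

/-- **Vertical increment under a relative derivative bound.**  `U` open convex, `G` holomorphic on `U`, `z ∈ U` with real foot
`↑(Re z) ∈ U`, and `‖G′(ζ)‖ ≤ κ·a` for all `ζ ∈ U` with `Re ζ = Re z` (in the application `a = A(Re z)`).  Then
`‖G z − G(Re z)‖ ≤ κ·a·|Im z|`. [folklore] -/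
theorem norm_sub_foot_le {U : Set ℂ} (hUo : IsOpen U) (hUc : Convex ℝ U) {G : ℂ → ℂ} (hG : DifferentiableOn ℂ G U)
    {z : ℂ} (hz : z ∈ U) (hfoot : ((z.re : ℝ) : ℂ) ∈ U) {κ a : ℝ}
    (hrel : ∀ ζ ∈ U, ζ.re = z.re → ‖deriv G ζ‖ ≤ κ * a) :
    ‖G z - G (z.re : ℂ)‖ ≤ κ * a * |z.im| := by
  have him : ‖z - (z.re : ℂ)‖ = |z.im| := by
    have : z - (z.re : ℂ) = (z.im : ℂ) * Complex.I := by
      apply Complex.ext <;> simp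
    rw [this, norm_mul, Complex.norm_I, mul_one, Complex.norm_real, Real.norm_eq_abs]
  rw [sub_eq_mul_integral_deriv hUo hUc hG hz hfoot, norm_mul, him]
  have hseg : ∀ t : ℝ, t ∈ Icc (0:ℝ) 1 → (z.re : ℂ) + (t : ℂ) * (z - (z.re : ℂ)) ∈ U := by
    intro t ht
    have h := hUc.add_smul_sub_mem hfoot hz ht
    simpa [Complex.real_smul] using h
  have hI : ‖∫ t in (0:ℝ)..1, deriv G ((z.re : ℂ) + (t : ℂ) * (z - (z.re : ℂ)))‖ ≤ (κ * a) * |1 - 0| := by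
    refine intervalIntegral.norm_integral_le_of_norm_le_const fun t ht => ?_
    rw [uIoc_of_le zero_le_one] at ht
    exact hrel _ (hseg t ⟨ht.1.le, ht.2⟩) (re_foot_add z t)
  rw [sub_zero, abs_one, mul_one] at hI
  calc |z.im| * ‖∫ t in (0:ℝ)..1, deriv G ((z.re : ℂ) + (t : ℂ) * (z - (z.re : ℂ)))‖ ≤ |z.im| * (κ * a) :=
        mul_le_mul_of_nonneg_left hI (abs_nonneg _)
    _ = κ * a * |z.im| := by ring

/-- **The factor-two window of `StadiumAnalyticArea` from a relative derivative bound.**  `U` open convex containing the real feet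
of its points; `G` holomorphic on `U` with real trace `G ↑x = ↑(A x)`, `A ≥ 0` on the trace; relative bound `‖G′(ζ)‖ ≤ κ·A(Re ζ)` on
`U`; thinness `κ·|Im z| ≤ 1/2` on `U`.  Then for every `z ∈ U`: `A(Re z)/2 ≤ Re G(z)` and `‖G(z)‖ ≤ 2·A(Re z)`. [folklore] -/
theorem stadium_window_of_relative_deriv_bound {U : Set ℂ} (hUo : IsOpen U) (hUc : Convex ℝ U) {G : ℂ → ℂ}
    (hG : DifferentiableOn ℂ G U) {A : ℝ → ℝ} (hfeet : ∀ z ∈ U, ((z.re : ℝ) : ℂ) ∈ U)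
    (htrace : ∀ x : ℝ, (x : ℂ) ∈ U → G x = ((A x : ℝ) : ℂ)) (hA : ∀ x : ℝ, (x : ℂ) ∈ U → 0 ≤ A x)
    {κ : ℝ} (hrel : ∀ ζ ∈ U, ‖deriv G ζ‖ ≤ κ * A ζ.re) (hthin : ∀ z ∈ U, κ * |z.im| ≤ 1 / 2) :
    ∀ z ∈ U, A z.re / 2 ≤ (G z).re ∧ ‖G z‖ ≤ 2 * A z.re := by
  intro z hz
  have hfoot := hfeet z hz
  have hA0 : 0 ≤ A z.re := hA z.re hfoot
  have hinc := norm_sub_foot_le hUo hUc hG hz hfoot (κ := κ) (a := A z.re)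
    (fun ζ hζ hre => by rw [← hre]; exact hrel ζ hζ)
  have hGfoot : G (z.re : ℂ) = ((A z.re : ℝ) : ℂ) := htrace z.re hfoot
  rw [hGfoot] at hinc
  have hhalf : ‖G z - ((A z.re : ℝ) : ℂ)‖ ≤ A z.re / 2 := by
    calc ‖G z - ((A z.re : ℝ) : ℂ)‖ ≤ κ * A z.re * |z.im| := hinc
      _ = (κ * |z.im|) * A z.re := by ring
      _ ≤ (1 / 2) * A z.re := mul_le_mul_of_nonneg_right (hthin z hz) hA0
      _ = A z.re / 2 := by ring
  constructor
  · -- real part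
    have hre : |(G z - ((A z.re : ℝ) : ℂ)).re| ≤ A z.re / 2 := (Complex.abs_re_le_norm _).trans hhalf
    rw [Complex.sub_re, Complex.ofReal_re] at hre
    have := (abs_le.1 hre).1
    linarith
  · -- modulus
    calc ‖G z‖ = ‖(G z - ((A z.re : ℝ) : ℂ)) + ((A z.re : ℝ) : ℂ)‖ := by rw [sub_add_cancel]
      _ ≤ ‖G z - ((A z.re : ℝ) : ℂ)‖ + ‖((A z.re : ℝ) : ℂ)‖ := norm_add_le _ _
      _ ≤ A z.re / 2 + A z.re := by
          rw [Complex.norm_real, Real.norm_eq_abs, abs_of_nonneg hA0]; linarith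
      _ ≤ 2 * A z.re := by linarith

end Summit.NavierStokesRegularity.NavierStokesRegularity.Theorems.AreaLawSlavingHolo
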